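import Literature.NumberTheory.Automorphic.AdelicGLnGlue
import HarnessLib

/-!
# The compact set of conjugated elementary directions in `𝔤𝔩₃(K_∞)` and the real parametrisation
# `exp (a · Ad(κ⁻¹)E_{ij}) = exp (t X)`, `|t| ≤ ‖a‖`, `X` in that set (socket (S) of the three-factor
# normal form feeding the oscillation estimate for the truncated kernel on `U(3)`)

Topic `NumberTheory/Automorphic`; namespace `Literature.NumberTheory.Automorphic`. Proof file:
theorems only (no definition, no named fact, no instance, no `sorry`); imports = tree + Mathlib.

THE POINT (Rogawski (1990), §2.2 p. 13; Gelbart (1975), (9.44)–(9.46)). High in the cusp the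
truncated kernel is an average of oscillations of the test function under right translation by
`g⁻¹ u g`, `u` in a fundamental domain of the Heisenberg group; read on `GL₃`, such a conjugate is a
product of three archimedean one-parameter elements `exp (aᵢ · Ad(κ⁻¹)E_{pᵢ})` with VECTOR
coefficients `aᵢ ∈ K_∞ = mixedSpace K` (★ `UnitaryGroup.adelicVal_borel_mul_conj_eq_threeFactor`,
`UnitaryGroupHeisenbergConjThreeFactor`), while the oscillation estimate ★
`UnitaryGroup.forall_norm_sub_conj_le_of_threeFactor` (`UnitaryGroupTruncatedKernelOscillation`)
consumes REAL parameters `tᵢ` and directions `Xᵢ` in ONE compact set `S`. This file is that socket,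
with the set written out (no definition is declared):

  `S(K∞) = {X | ∃ κ ∈ K∞, ∃ a, ‖a‖ ≤ 1 ∧ ∃ p ∈ {(0,2),(0,1),(1,2)}, X = a • (κ⁻¹ E_p κ)}`.

* §1 `isCompact_threeDirections` — `S(K∞)` is compact for compact `K∞ ⊆ GL₃(K_∞)` (continuous image
  of `K∞ × closedBall 0 1 × {three pairs}`).
* §2 `exists_real_param` — `exp (a · Ad(κ⁻¹)E_p) = exp (t X)` with `t = ‖a‖`, `X ∈ S(K∞)`
  (`X = (a∕‖a‖) · Ad(κ⁻¹)E_p`; `X = 0 • Ad(κ⁻¹)E_p` if `a = 0`); `exists_real_params_three` — the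
  three-fold form with `|tᵢ| ≤ ρ` from `‖aᵢ‖ ≤ ρ`, in the letters of the oscillation estimate.

## References

* J. D. Rogawski, *Automorphic Representations of Unitary Groups in Three Variables*, Ann. of
  Math. Studies 123 (1990), §2.2 (p. 13) [Rogawski1990].
* S. Gelbart, *Automorphic forms on adele groups*, Ann. of Math. Studies 83 (1975), §9.B
  (9.44)–(9.46) [Gelbart1975].
-/

set_option autoImplicit false

noncomputable section

-- `open scoped Classical` is needed to see the Mathlib (normed ring) instances on `mixedSpace K` (note H5 of
-- `AdelicGLnGlue`)
open scoped MatrixGroups Matrix Classical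
open NumberField NumberField.mixedEmbedding IsDedekindDomain Set

namespace Literature.NumberTheory.Automorphic

variable {K : Type} [Field K] [NumberField K]

/-! ## §1 The set of conjugated elementary directions is compact -/

omit [NumberField K] in
/-- `(κ, a) ↦ a • (κ⁻¹ E_{ij} κ) : GL₃(K_∞) × K_∞ → M₃(K_∞)` is continuous. [folklore] -/
private theorem continuous_smul_conj_single (i j : Fin 3) :
    Continuous fun q : GL (Fin 3) (mixedSpace K) × mixedSpace K =>
      q.2 • ((((q.1⁻¹ : GL (Fin 3) (mixedSpace K)) : Matrix (Fin 3) (Fin 3) (mixedSpace K)) *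
        Matrix.single i j 1 * (q.1 : Matrix (Fin 3) (Fin 3) (mixedSpace K)))) :=
  continuous_snd.smul
    (((Units.continuous_coe_inv.comp continuous_fst).mul continuous_const).mul
      (Units.continuous_val.comp continuous_fst))

/-- **THE SET OF THREE CONJUGATED DIRECTIONS IS COMPACT**: for a compact `K∞ ⊆ GL₃(K_∞)` the set
`{X | ∃ κ ∈ K∞, ∃ a, ‖a‖ ≤ 1 ∧ ∃ p ∈ {(0,2),(0,1),(1,2)}, X = a • (κ⁻¹ E_p κ)}` is compact (it is the
continuous image of `K∞ × closedBall 0 1 × {three pairs}`) — the uniform family of directions of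
the oscillation estimate of Rogawski's §2.2. [cite: Rogawski1990, §2.2 (p. 13)] -/
theorem isCompact_threeDirections {Kc : Set (GL (Fin 3) (mixedSpace K))} (hK : IsCompact Kc) :
    IsCompact {X : Matrix (Fin 3) (Fin 3) (mixedSpace K) |
      ∃ κ ∈ Kc, ∃ a : mixedSpace K, ‖a‖ ≤ 1 ∧
        ∃ p ∈ ({((0 : Fin 3), (2 : Fin 3)), (0, 1), (1, 2)} : Set (Fin 3 × Fin 3)),
          X = a • ((((κ⁻¹ : GL (Fin 3) (mixedSpace K)) : Matrix (Fin 3) (Fin 3) (mixedSpace K)) *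
            Matrix.single p.1 p.2 1 * (κ : Matrix (Fin 3) (Fin 3) (mixedSpace K))))} := by
  -- the parametrisation
  have himage : {X : Matrix (Fin 3) (Fin 3) (mixedSpace K) |
      ∃ κ ∈ Kc, ∃ a : mixedSpace K, ‖a‖ ≤ 1 ∧
        ∃ p ∈ ({((0 : Fin 3), (2 : Fin 3)), (0, 1), (1, 2)} : Set (Fin 3 × Fin 3)),
          X = a • ((((κ⁻¹ : GL (Fin 3) (mixedSpace K)) : Matrix (Fin 3) (Fin 3) (mixedSpace K)) *
            Matrix.single p.1 p.2 1 * (κ : Matrix (Fin 3) (Fin 3) (mixedSpace K))))} =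
      (fun q : (GL (Fin 3) (mixedSpace K) × mixedSpace K) × (Fin 3 × Fin 3) =>
          q.1.2 • ((((q.1.1⁻¹ : GL (Fin 3) (mixedSpace K)) : Matrix (Fin 3) (Fin 3) (mixedSpace K)) *
            Matrix.single q.2.1 q.2.2 1 * (q.1.1 : Matrix (Fin 3) (Fin 3) (mixedSpace K))))) ''
        ((Kc ×ˢ Metric.closedBall (0 : mixedSpace K) 1) ×ˢ
          ({((0 : Fin 3), (2 : Fin 3)), (0, 1), (1, 2)} : Set (Fin 3 × Fin 3))) := by
    ext X
    constructor
    · rintro ⟨κ, hκ, a, ha, p, hp, rfl⟩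
      exact ⟨((κ, a), p), ⟨⟨hκ, mem_closedBall_zero_iff.2 ha⟩, hp⟩, rfl⟩
    · rintro ⟨⟨⟨κ, a⟩, p⟩, ⟨⟨hκ, ha⟩, hp⟩, rfl⟩
      exact ⟨κ, hκ, a, mem_closedBall_zero_iff.1 ha, p, hp, rfl⟩
  rw [himage]
  refine ((hK.prod (isCompact_closedBall (0 : mixedSpace K) 1)).prod (Set.toFinite _).isCompact).image ?_
  exact continuous_prod_of_discrete_right.2 fun p => continuous_smul_conj_single p.1 p.2

/-! ## §2 The real parametrisation of an elementary factor -/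

/-- **`exp (a · Ad(κ⁻¹)E_p) = exp (t X)` with a REAL parameter `|t| ≤ ‖a‖` and a direction `X` in the
compact set of §1** (`t = ‖a‖`, `X = (a∕‖a‖) · Ad(κ⁻¹)E_p`; for `a = 0`: `t = 0`, `X = 0 · Ad(κ⁻¹)E_p`).
[cite: Rogawski1990, §2.2 (p. 13)] -/
theorem exists_real_param {Kc : Set (GL (Fin 3) (mixedSpace K))} {κ : GL (Fin 3) (mixedSpace K)}
    (hκ : κ ∈ Kc) (a : mixedSpace K) {p : Fin 3 × Fin 3}
    (hp : p ∈ ({((0 : Fin 3), (2 : Fin 3)), (0, 1), (1, 2)} : Set (Fin 3 × Fin 3))) :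
    ∃ t : ℝ, ∃ X ∈ {X : Matrix (Fin 3) (Fin 3) (mixedSpace K) |
      ∃ κ ∈ Kc, ∃ a : mixedSpace K, ‖a‖ ≤ 1 ∧
        ∃ p ∈ ({((0 : Fin 3), (2 : Fin 3)), (0, 1), (1, 2)} : Set (Fin 3 × Fin 3)),
          X = a • ((((κ⁻¹ : GL (Fin 3) (mixedSpace K)) : Matrix (Fin 3) (Fin 3) (mixedSpace K)) *
            Matrix.single p.1 p.2 1 * (κ : Matrix (Fin 3) (Fin 3) (mixedSpace K))))},
      |t| ≤ ‖a‖ ∧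
      expGL (a • ((((κ⁻¹ : GL (Fin 3) (mixedSpace K)) : Matrix (Fin 3) (Fin 3) (mixedSpace K)) *
          Matrix.single p.1 p.2 1 * (κ : Matrix (Fin 3) (Fin 3) (mixedSpace K))))) = expGL (t • X) := by
  set Y : Matrix (Fin 3) (Fin 3) (mixedSpace K) :=
    (((κ⁻¹ : GL (Fin 3) (mixedSpace K)) : Matrix (Fin 3) (Fin 3) (mixedSpace K)) *
      Matrix.single p.1 p.2 1 * (κ : Matrix (Fin 3) (Fin 3) (mixedSpace K))) with hY
  by_cases ha : a = 0
  · refine ⟨0, (0 : mixedSpace K) • Y, ⟨κ, hκ, 0, by simp, p, hp, rfl⟩, by simp, ?_⟩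
    rw [ha, zero_smul, zero_smul]
  · have hn : ‖a‖ ≠ 0 := norm_ne_zero_iff.2 ha
    refine ⟨‖a‖, (‖a‖⁻¹ • a) • Y, ⟨κ, hκ, ‖a‖⁻¹ • a, ?_, p, hp, rfl⟩, ?_, ?_⟩
    · rw [_root_.norm_smul, norm_inv, norm_norm, inv_mul_cancel₀ hn]
    · rw [abs_norm]
    · congr 1
      rw [smul_assoc, ← smul_assoc ‖a‖ ‖a‖⁻¹ (a • Y), smul_eq_mul, mul_inv_cancel₀ hn, one_smul]

/-- **The three-fold form**: three elementary factors `exp (aᵢ · Ad(κ⁻¹)E_{pᵢ})` with `‖aᵢ‖ ≤ ρ`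
become `exp (tᵢ Xᵢ)` with `Xᵢ` in the compact set of §1 and `|tᵢ| ≤ ρ` — the format
`hgeom` of ★ `UnitaryGroup.forall_norm_sub_conj_le_of_threeFactor`. [cite: Rogawski1990, §2.2 (p. 13)] -/
theorem exists_real_params_three {Kc : Set (GL (Fin 3) (mixedSpace K))} {κ : GL (Fin 3) (mixedSpace K)}
    (hκ : κ ∈ Kc) {a₁ a₂ a₃ : mixedSpace K} {ρ : ℝ} (h₁ : ‖a₁‖ ≤ ρ) (h₂ : ‖a₂‖ ≤ ρ) (h₃ : ‖a₃‖ ≤ ρ)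
    {p₁ p₂ p₃ : Fin 3 × Fin 3}
    (hp₁ : p₁ ∈ ({((0 : Fin 3), (2 : Fin 3)), (0, 1), (1, 2)} : Set (Fin 3 × Fin 3)))
    (hp₂ : p₂ ∈ ({((0 : Fin 3), (2 : Fin 3)), (0, 1), (1, 2)} : Set (Fin 3 × Fin 3)))
    (hp₃ : p₃ ∈ ({((0 : Fin 3), (2 : Fin 3)), (0, 1), (1, 2)} : Set (Fin 3 × Fin 3))) :
    ∃ (t₁ t₂ t₃ : ℝ) (X₁ X₂ X₃ : Matrix (Fin 3) (Fin 3) (mixedSpace K)),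
      X₁ ∈ {X : Matrix (Fin 3) (Fin 3) (mixedSpace K) |
        ∃ κ ∈ Kc, ∃ a : mixedSpace K, ‖a‖ ≤ 1 ∧
          ∃ p ∈ ({((0 : Fin 3), (2 : Fin 3)), (0, 1), (1, 2)} : Set (Fin 3 × Fin 3)),
            X = a • ((((κ⁻¹ : GL (Fin 3) (mixedSpace K)) : Matrix (Fin 3) (Fin 3) (mixedSpace K)) *
              Matrix.single p.1 p.2 1 * (κ : Matrix (Fin 3) (Fin 3) (mixedSpace K))))} ∧
      X₂ ∈ {X : Matrix (Fin 3) (Fin 3) (mixedSpace K) |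
        ∃ κ ∈ Kc, ∃ a : mixedSpace K, ‖a‖ ≤ 1 ∧
          ∃ p ∈ ({((0 : Fin 3), (2 : Fin 3)), (0, 1), (1, 2)} : Set (Fin 3 × Fin 3)),
            X = a • ((((κ⁻¹ : GL (Fin 3) (mixedSpace K)) : Matrix (Fin 3) (Fin 3) (mixedSpace K)) *
              Matrix.single p.1 p.2 1 * (κ : Matrix (Fin 3) (Fin 3) (mixedSpace K))))} ∧
      X₃ ∈ {X : Matrix (Fin 3) (Fin 3) (mixedSpace K) |
        ∃ κ ∈ Kc, ∃ a : mixedSpace K, ‖a‖ ≤ 1 ∧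
          ∃ p ∈ ({((0 : Fin 3), (2 : Fin 3)), (0, 1), (1, 2)} : Set (Fin 3 × Fin 3)),
            X = a • ((((κ⁻¹ : GL (Fin 3) (mixedSpace K)) : Matrix (Fin 3) (Fin 3) (mixedSpace K)) *
              Matrix.single p.1 p.2 1 * (κ : Matrix (Fin 3) (Fin 3) (mixedSpace K))))} ∧
      |t₁| ≤ ρ ∧ |t₂| ≤ ρ ∧ |t₃| ≤ ρ ∧
      expGL (a₁ • ((((κ⁻¹ : GL (Fin 3) (mixedSpace K)) : Matrix (Fin 3) (Fin 3) (mixedSpace K)) *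
            Matrix.single p₁.1 p₁.2 1 * (κ : Matrix (Fin 3) (Fin 3) (mixedSpace K))))) *
        expGL (a₂ • ((((κ⁻¹ : GL (Fin 3) (mixedSpace K)) : Matrix (Fin 3) (Fin 3) (mixedSpace K)) *
            Matrix.single p₂.1 p₂.2 1 * (κ : Matrix (Fin 3) (Fin 3) (mixedSpace K))))) *
        expGL (a₃ • ((((κ⁻¹ : GL (Fin 3) (mixedSpace K)) : Matrix (Fin 3) (Fin 3) (mixedSpace K)) *
            Matrix.single p₃.1 p₃.2 1 * (κ : Matrix (Fin 3) (Fin 3) (mixedSpace K))))) =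
      expGL (t₁ • X₁) * expGL (t₂ • X₂) * expGL (t₃ • X₃) := by
  obtain ⟨t₁, X₁, hX₁, ht₁, e₁⟩ := exists_real_param hκ a₁ hp₁
  obtain ⟨t₂, X₂, hX₂, ht₂, e₂⟩ := exists_real_param hκ a₂ hp₂
  obtain ⟨t₃, X₃, hX₃, ht₃, e₃⟩ := exists_real_param hκ a₃ hp₃
  exact ⟨t₁, t₂, t₃, X₁, X₂, X₃, hX₁, hX₂, hX₃, ht₁.trans h₁, ht₂.trans h₂, ht₃.trans h₃,
    by rw [e₁, e₂, e₃]⟩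

end Literature.NumberTheory.Automorphic

end
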